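import Summits.ResolutionOfSingularities.ResolutionOfSingularities.Theorems.WeightedInvariantContactCylinderOpenPresentation
import Literature.AlgebraicGeometry.Resolution.CobordantBlowupRegularCentre
import Literature.AlgebraicGeometry.Resolution.CobordantBlowupExtReesBridge
import Literature.AlgebraicGeometry.Resolution.CotangentIndependenceSpread
import Literature.AlgebraicGeometry.Resolution.FieldsJ2
import Summits.ResolutionOfSingularities.ResolutionOfSingularities.Theorems.FrobeniusLadderFRationalResolutionRegularRingLocalization
import HarnessLib

/-!
# THE GLOBAL CYLINDER MOVE IS A REGULAR RING over a basic open along the curve ((G1-reg) for res-type-047's (D2) «finiteness of tie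
# points»: res-type-047 13:33:01Z «regularity of the X-chart `Localization.Away X` of B for a regular weighted centre — name the decl»)
# (door `HypersurfaceCentreConstruction`, stmt-ResolutionOfSingularities-19897; KEY `stub_localWeightedDropEFT4S`, regime P3a)

Topic: `Summits/ResolutionOfSingularities/ResolutionOfSingularities/Theorems`. Helper for the door item
`HypersurfaceCentreConstruction` (stmt-ResolutionOfSingularities-19897, route `WeightedInvariant`), line `local-engine` of
res-L1-w43-plan-1 (L W4.3).  No new objects.  res-type-048's Literature theorem
`cobordantAlgebra.isRegularRing_of_linearIndependent_toCotangent` (Włodarczyk 2.3.9: the full cobordant blow-up algebra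
`A[t⁻¹, uᵢ t^{wᵢ}]` of a regular ring at a centre whose members have independent differentials at the points of `V(u)` is a
regular ring) is repackaged in the letters the (D2) consumer reads: (1) for `B = extReesAlgebra (weightedMonomialIdeal U W)`
(= `cobordantAlgebra U W`, res-type-048's bridge) and every localisation `Localization M` of it (in particular the `X`-chart
`Localization.Away X`; localisations of regular rings are regular: `FRationalResolution.stub_isRegularRing_localization`); (2) over the basic-open ring `A_h = Localization.Away h` of a Noetherian model ring `A`, from the POINTWISE
data on `D(h)` that the uniform presentation along the curve delivers (`exists_open_rsp_pair_along_prime`, p522933: `A_𝔮` regular and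
`x, g` independent in `𝔪_𝔮/𝔪_𝔮²` at every `𝔮 ∈ V(x, g) ∩ D(h)`) plus pointwise regularity of `A` on `D(h)` (the regular locus of a
finite-type algebra over a field is open: `isOpen_regularLocus_of_finiteType_field`); (3) the door corollary: for `A` of finite type
over a perfect field, `𝔭` a prime with `A_𝔭` regular of dimension `2` and `(x, g) A_𝔭 = 𝔭 A_𝔭`, there is `h ∉ 𝔭` such that for EVERY
further shrink `h·h'` the global move `extReesAlgebra (weightedMonomialIdeal (x/1, g/1) (1, b))` over `A_{h h'}` and all its
localisations are regular rings (pointwise hypotheses are monotone under shrinking, so the consumer may intersect `D(h)` with any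
other basic open he needs — generic drop, regular locus of the curve — at no cost).

[OURS · L1 W4.3 · (o28) P3a]  Replaces the role of NO printed item; NOT a statement of the manuscript
[claim: Hironaka2017, status: under-review]. AI work, weaker than expert review.  Pure commutative algebra; no named facts.

## References

* J. Włodarczyk, *Functorial resolution except for toroidal locus. Toroidal compactification*, 2.1.10, §2.3.9. [Wlodarczyk2022]
* H. Matsumura, *Commutative Ring Theory*, Thm. 14.2, §24, §30. [Matsumura1987]
* res-type-047 INPUT 2026-08-27T13:33:01Z ((G1) shape); res-L1-w43-plan-1 RULING gen 11 #5/#6 (OURS, AI planning).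
-/

noncomputable section

open IsLocalRing Literature.AlgebraicGeometry.Resolution LaurentPolynomial

set_option linter.dupNamespace false -- mandated namespace of this single-conjunct summit

namespace Summit.ResolutionOfSingularities.ResolutionOfSingularities.Theorems

namespace ContactCylinder

/-! ## (1) Regularity and finiteness of `extReesAlgebra (weightedMonomialIdeal U W)` and of its localisations -/

/-- **The global move `B = extReesAlgebra (weightedMonomialIdeal U W)` of a regular weighted centre on a regular ring is a regular
ring** (Włodarczyk 2.3.9 in res-type-048's affine form, transported along the bridge `extReesAlgebra (weightedMonomialIdeal U W) =
cobordantAlgebra U W`): `A` regular, positive weights, and at every prime `P ⊇ (U)` some localisation of `A` at `P` is a regular local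
ring in whose cotangent space the `Uᵢ` are linearly independent. [cite: Wlodarczyk2022, §2.3.9] -/
theorem isRegularRing_extReesAlgebra_weightedMonomialIdeal {A : Type} [CommRing A] [IsRegularRing A] {m : ℕ} (U : Fin m → A)
    (W : Fin m → ℕ) (hW : ∀ i, 0 < W i)
    (hloc : ∀ (P : Ideal A) [P.IsPrime], Ideal.span (Set.range U) ≤ P →
      ∃ (R : Type) (_ : CommRing R) (_ : Algebra A R) (_ : IsLocalization.AtPrime R P)
        (_ : IsRegularLocalRing R) (hmem : ∀ i, algebraMap A R (U i) ∈ maximalIdeal R),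
        LinearIndependent (ResidueField R) fun i => (maximalIdeal R).toCotangent ⟨algebraMap A R (U i), hmem i⟩) :
    IsRegularRing (extReesAlgebra (weightedMonomialIdeal U W)) := by
  rw [extReesAlgebra_weightedMonomialIdeal_eq_cobordantAlgebra]
  exact cobordantAlgebra.isRegularRing_of_linearIndependent_toCotangent U W hW hloc

/-- **Every localisation of the global move of a regular weighted centre on a regular ring is a regular ring** — in particular the
`X`-chart `Localization.Away X` (`X = x t`) on which res-type-047 reads the order of the transform. [cite: Wlodarczyk2022, §2.3.9] -/
theorem isRegularRing_localization_extReesAlgebra_weightedMonomialIdeal {A : Type} [CommRing A] [IsRegularRing A] {m : ℕ}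
    (U : Fin m → A) (W : Fin m → ℕ) (hW : ∀ i, 0 < W i)
    (hloc : ∀ (P : Ideal A) [P.IsPrime], Ideal.span (Set.range U) ≤ P →
      ∃ (R : Type) (_ : CommRing R) (_ : Algebra A R) (_ : IsLocalization.AtPrime R P)
        (_ : IsRegularLocalRing R) (hmem : ∀ i, algebraMap A R (U i) ∈ maximalIdeal R),
        LinearIndependent (ResidueField R) fun i => (maximalIdeal R).toCotangent ⟨algebraMap A R (U i), hmem i⟩)
    (M : Submonoid (extReesAlgebra (weightedMonomialIdeal U W))) : IsRegularRing (Localization M) := by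
  haveI := isRegularRing_extReesAlgebra_weightedMonomialIdeal U W hW hloc
  exact FRationalResolution.stub_isRegularRing_localization M

/-- The global move `extReesAlgebra (weightedMonomialIdeal U W)` is of finite type over the model ring (res-type-048's
`finiteType_cobordantAlgebra` across the bridge) — with `A` Noetherian, `Spec B → Spec A` is of finite presentation, as Chevalley's
theorem wants. [cite: Wlodarczyk2022, Def. 2.3.5] -/
theorem finiteType_extReesAlgebra_weightedMonomialIdeal {A : Type} [CommRing A] {m : ℕ} (U : Fin m → A) (W : Fin m → ℕ) :
    Algebra.FiniteType A (extReesAlgebra (weightedMonomialIdeal U W)) := by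
  rw [extReesAlgebra_weightedMonomialIdeal_eq_cobordantAlgebra]
  exact finiteType_cobordantAlgebra U W

/-- The charts `Localization.Away X` of the global move are of finite type over the model ring. [folklore] -/
theorem finiteType_away_extReesAlgebra_weightedMonomialIdeal {A : Type} [CommRing A] {m : ℕ} (U : Fin m → A) (W : Fin m → ℕ)
    (X : extReesAlgebra (weightedMonomialIdeal U W)) : Algebra.FiniteType A (Localization.Away X) := by
  haveI := finiteType_extReesAlgebra_weightedMonomialIdeal U W
  haveI : Algebra.FiniteType (extReesAlgebra (weightedMonomialIdeal U W)) (Localization.Away X) :=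
    IsLocalization.finiteType_of_monoid_fg (Submonoid.powers X) _
  exact Algebra.FiniteType.trans (S := extReesAlgebra (weightedMonomialIdeal U W)) inferInstance inferInstance

/-! ## (2) Over a basic open `D(h)`: pointwise hypotheses on `D(h)` ⇒ the global move over `A_h` is a regular ring -/

/-- `A_h` is a regular ring as soon as `A_𝔮` is a regular local ring for every prime `𝔮 ∌ h` (`A` Noetherian): the local rings of
`A_h` are the `A_𝔮`, `𝔮 ∈ D(h)`. [folklore] -/
theorem isRegularRing_away_of_forall {A : Type} [CommRing A] [IsNoetherianRing A] (h : A)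
    (hreg : ∀ (𝔮 : Ideal A) [𝔮.IsPrime], h ∉ 𝔮 → IsRegularLocalRing (Localization.AtPrime 𝔮)) :
    IsRegularRing (Localization.Away h) := by
  haveI : IsNoetherianRing (Localization.Away h) :=
    IsLocalization.isNoetherianRing (Submonoid.powers h) (Localization.Away h) inferInstance
  refine (isRegularRing_iff (R := Localization.Away h)).2 fun P hP => ?_
  haveI : IsLocalization.AtPrime (Localization.AtPrime P) (P.under A) :=
    IsLocalization.isLocalization_isLocalization_atPrime_isLocalization (Submonoid.powers h) (Localization.AtPrime P) P
  have hh : h ∉ P.under A := fun hhP =>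
    hP.ne_top (P.eq_top_of_isUnit_mem (Ideal.mem_comap.1 hhP) (IsLocalization.Away.algebraMap_isUnit h))
  haveI := hreg (P.under A) hh
  exact IsRegularLocalRing.of_ringEquiv (R := Localization.AtPrime (P.under A))
    (IsLocalization.algEquiv (P.under A).primeCompl (Localization.AtPrime (P.under A)) (Localization.AtPrime P)).toRingEquiv

/-- **Pointwise-to-global regularity of the global move over a basic open.**  `A` Noetherian, `h ∈ A`, `U : Fin m → A`, positive
weights; suppose that for every prime `𝔮 ∌ h`: `A_𝔮` is regular, and if moreover all `Uᵢ ∈ 𝔮` then the `Uᵢ/1` are linearly independent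
in `𝔪_𝔮/𝔪_𝔮²`.  Then the global move `extReesAlgebra (weightedMonomialIdeal (U/1) W)` over `A_h` is a regular ring.  (The hypotheses are
monotone in `h`: they persist on every smaller basic open `D(h h')`.) [cite: Wlodarczyk2022, 2.1.10 and §2.3.9] -/
theorem isRegularRing_extReesAlgebra_weightedMonomialIdeal_away {A : Type} [CommRing A] [IsNoetherianRing A] (h : A) {m : ℕ}
    (U : Fin m → A) (W : Fin m → ℕ) (hW : ∀ i, 0 < W i)
    (hreg : ∀ (𝔮 : Ideal A) [𝔮.IsPrime], h ∉ 𝔮 → IsRegularLocalRing (Localization.AtPrime 𝔮))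
    (hli : ∀ (𝔮 : Ideal A) [𝔮.IsPrime], h ∉ 𝔮 → (∀ i, U i ∈ 𝔮) →
      ∃ hU : ∀ i, algebraMap A (Localization.AtPrime 𝔮) (U i) ∈ maximalIdeal (Localization.AtPrime 𝔮),
        LinearIndependent (ResidueField (Localization.AtPrime 𝔮)) fun i =>
          (maximalIdeal (Localization.AtPrime 𝔮)).toCotangent ⟨algebraMap A _ (U i), hU i⟩) :
    IsRegularRing (extReesAlgebra (weightedMonomialIdeal (fun i => algebraMap A (Localization.Away h) (U i)) W)) := by
  haveI := isRegularRing_away_of_forall h hreg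
  refine isRegularRing_extReesAlgebra_weightedMonomialIdeal _ W hW fun P _ hP => ?_
  -- `𝔮 = P ∩ A ∌ h` contains the `Uᵢ`; `R := (A_h)_P` is a localisation of `A` at `𝔮`
  have hh : h ∉ P.under A := fun hhP =>
    ‹P.IsPrime›.ne_top (P.eq_top_of_isUnit_mem (Ideal.mem_comap.1 hhP) (IsLocalization.Away.algebraMap_isUnit h))
  have hU𝔮 : ∀ i, U i ∈ P.under A := fun i =>
    Ideal.mem_comap.2 (hP (Ideal.subset_span ⟨i, rfl⟩))
  haveI : IsLocalization.AtPrime (Localization.AtPrime P) (P.under A) :=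
    IsLocalization.isLocalization_isLocalization_atPrime_isLocalization (Submonoid.powers h) (Localization.AtPrime P) P
  haveI := hreg (P.under A) hh
  obtain ⟨hU, hli𝔮⟩ := hli (P.under A) hh hU𝔮
  let e : Localization.AtPrime (P.under A) ≃ₐ[A] Localization.AtPrime P :=
    IsLocalization.algEquiv (P.under A).primeCompl (Localization.AtPrime (P.under A)) (Localization.AtPrime P)
  haveI : IsRegularLocalRing (Localization.AtPrime P) := IsRegularLocalRing.of_ringEquiv e.toRingEquiv
  have he : ∀ i, e.toRingEquiv (algebraMap A (Localization.AtPrime (P.under A)) (U i)) =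
      algebraMap (Localization.Away h) (Localization.AtPrime P) (algebraMap A (Localization.Away h) (U i)) := fun i => by
    rw [AlgEquiv.coe_ringEquiv, AlgEquiv.commutes, IsScalarTower.algebraMap_apply A (Localization.Away h)
      (Localization.AtPrime P)]
  have hmem : ∀ i, algebraMap (Localization.Away h) (Localization.AtPrime P) (algebraMap A (Localization.Away h) (U i)) ∈
      maximalIdeal (Localization.AtPrime P) := fun i => by
    rw [← he i, AlgEquiv.coe_ringEquiv]
    exact (map_mem_nonunits_iff _ _).mpr (hU i)
  have hex : ∀ i, e.toRingEquiv (algebraMap A (Localization.AtPrime (P.under A)) (U i)) ∈ maximalIdeal (Localization.AtPrime P) :=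
    fun i => (he i).symm ▸ hmem i
  have hli' := linearIndependent_toCotangent_map_ringEquiv e.toRingEquiv (fun i => algebraMap A _ (U i)) hU hli𝔮 hex
  refine ⟨Localization.AtPrime P, inferInstance, inferInstance, inferInstance, inferInstance, hmem, ?_⟩
  have hfun : (fun i => (maximalIdeal (Localization.AtPrime P)).toCotangent
        ⟨e.toRingEquiv (algebraMap A (Localization.AtPrime (P.under A)) (U i)), hex i⟩) =
      (fun i => (maximalIdeal (Localization.AtPrime P)).toCotangent
        ⟨algebraMap (Localization.Away h) (Localization.AtPrime P) (algebraMap A (Localization.Away h) (U i)), hmem i⟩) := by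
    funext i
    congr 1
    exact Subtype.ext (he i)
  rw [hfun] at hli'
  exact hli'

/-- The PAIR form, with the hypotheses literally as `exists_open_rsp_pair_along_prime` (p522933) delivers them on `D(h)`:
the global cylinder move `extReesAlgebra (weightedMonomialIdeal (x/1, g/1) (1, b))` over `A_h` is a regular ring, for every `b ≥ 1`.
[cite: Wlodarczyk2022, 2.1.10 and §2.3.9] -/
theorem isRegularRing_extReesAlgebra_pair_away {A : Type} [CommRing A] [IsNoetherianRing A] (h x g : A) (b : ℕ) (hb : 1 ≤ b)
    (hreg : ∀ (𝔮 : Ideal A) [𝔮.IsPrime], h ∉ 𝔮 → IsRegularLocalRing (Localization.AtPrime 𝔮))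
    (hli : ∀ (𝔮 : Ideal A) [𝔮.IsPrime], h ∉ 𝔮 → x ∈ 𝔮 → g ∈ 𝔮 →
      ∃ h𝔮 : ∀ i, algebraMap A (Localization.AtPrime 𝔮) ((![x, g] : Fin 2 → A) i) ∈ maximalIdeal (Localization.AtPrime 𝔮),
        LinearIndependent (ResidueField (Localization.AtPrime 𝔮)) fun i =>
          (maximalIdeal (Localization.AtPrime 𝔮)).toCotangent ⟨algebraMap A _ ((![x, g] : Fin 2 → A) i), h𝔮 i⟩) :
    IsRegularRing (extReesAlgebra (weightedMonomialIdeal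
      (fun i => algebraMap A (Localization.Away h) ((![x, g] : Fin 2 → A) i)) ![1, b])) := by
  refine isRegularRing_extReesAlgebra_weightedMonomialIdeal_away h ![x, g] ![1, b] ?_ hreg fun 𝔮 _ hh𝔮 hU => ?_
  · intro i
    fin_cases i
    · exact Nat.one_pos
    · exact hb
  · exact hli 𝔮 hh𝔮 (hU 0) (hU 1)

/-! ## (3) The door corollary: a basic open along the curve over which every shrink of the global move is regular -/

/-- **The regular locus is open, ring form at a point**: `A` of finite type over a field, `𝔭` a prime with `A_𝔭` regular ⇒ there is
`h ∉ 𝔭` with `A_𝔮` regular for every prime `𝔮 ∌ h` (`isOpen_regularLocus_of_finiteType_field`: fields are J-2).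
[cite: Matsumura1987, §30 Cor. to Thm. 30.5 and §32] -/
theorem exists_notMem_forall_isRegularLocalRing (k A : Type) [Field k] [CommRing A] [Algebra k A] [Algebra.FiniteType k A]
    (𝔭 : Ideal A) [𝔭.IsPrime] [IsRegularLocalRing (Localization.AtPrime 𝔭)] :
    ∃ h ∉ 𝔭, ∀ (𝔮 : Ideal A) [𝔮.IsPrime], h ∉ 𝔮 → IsRegularLocalRing (Localization.AtPrime 𝔮) := by
  have hopen : IsOpen (regularLocus A) := isOpen_regularLocus_of_finiteType_field k A
  have hp : (⟨𝔭, inferInstance⟩ : PrimeSpectrum A) ∈ regularLocus A := (mem_regularLocus _).2 inferInstance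
  obtain ⟨_, ⟨h, rfl⟩, hph, hsub⟩ := PrimeSpectrum.isTopologicalBasis_basic_opens.exists_subset_of_mem_open hp hopen
  refine ⟨h, (PrimeSpectrum.mem_basicOpen _ _).1 hph, fun 𝔮 _ hh𝔮 => ?_⟩
  exact (mem_regularLocus ⟨𝔮, inferInstance⟩).1 (hsub ((PrimeSpectrum.mem_basicOpen _ ⟨𝔮, inferInstance⟩).2 hh𝔮))

/-- **(G1-reg) THE GLOBAL CYLINDER MOVE IS REGULAR OVER A BASIC OPEN ALONG THE CURVE, AND STAYS SO UNDER EVERY SHRINK.**  `A` of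
finite type over a perfect field `k`, `𝔭` a prime with `A_𝔭` regular of dimension `2` and `(x, g) A_𝔭 = 𝔭 A_𝔭`.  Then there is
`h ∉ 𝔭` such that for EVERY `h' ∈ A`: `A_{h h'}` is a regular ring, the global move `B = extReesAlgebra (weightedMonomialIdeal
(x/1, g/1) (1, b))` over `A_{h h'}` is a regular ring of finite type over `A_{h h'}` (any `b ≥ 1`), and every localisation of `B` —
in particular the chart `Localization.Away X` — is a regular ring; moreover on `D(h)` the uniform data of
`exists_open_rsp_pair_along_prime` hold (`𝔭 ≤ 𝔮`, `A_𝔮` regular, `(x, g) A_𝔮 = 𝔭 A_𝔮`, `x, g` independent in `𝔪_𝔮/𝔪_𝔮²` at every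
`𝔮 ∈ V(x, g) ∩ D(h)`). [cite: Wlodarczyk2022, 2.1.10 and §2.3.9; Matsumura1987, §30] -/
theorem exists_basicOpen_isRegularRing_globalMove (k : Type) [Field k] [PerfectField k] (A : Type) [CommRing A] [Algebra k A]
    [Algebra.FiniteType k A] (𝔭 : Ideal A) [𝔭.IsPrime] [IsRegularLocalRing (Localization.AtPrime 𝔭)]
    (hdim : ringKrullDim (Localization.AtPrime 𝔭) = 2) (x g : A)
    (hxg : (Ideal.span {x, g}).map (algebraMap A (Localization.AtPrime 𝔭)) = maximalIdeal (Localization.AtPrime 𝔭))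
    (b : ℕ) (hb : 1 ≤ b) :
    ∃ h ∉ 𝔭,
      (∀ (𝔮 : Ideal A) [𝔮.IsPrime], h ∉ 𝔮 → IsRegularLocalRing (Localization.AtPrime 𝔮)) ∧
      (∀ (𝔮 : Ideal A) [𝔮.IsPrime], h ∉ 𝔮 → x ∈ 𝔮 → g ∈ 𝔮 →
        𝔭 ≤ 𝔮 ∧ IsRegularLocalRing (Localization.AtPrime 𝔮) ∧
        (Ideal.span {x, g}).map (algebraMap A (Localization.AtPrime 𝔮)) = 𝔭.map (algebraMap A (Localization.AtPrime 𝔮)) ∧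
        ∃ h𝔮 : ∀ i, algebraMap A (Localization.AtPrime 𝔮) ((![x, g] : Fin 2 → A) i) ∈ maximalIdeal (Localization.AtPrime 𝔮),
          LinearIndependent (ResidueField (Localization.AtPrime 𝔮)) fun i =>
            (maximalIdeal (Localization.AtPrime 𝔮)).toCotangent ⟨algebraMap A _ ((![x, g] : Fin 2 → A) i), h𝔮 i⟩) ∧
      ∀ h' : A,
        IsRegularRing (Localization.Away (h * h')) ∧
        Algebra.FiniteType (Localization.Away (h * h')) (extReesAlgebra (weightedMonomialIdeal
          (fun i => algebraMap A (Localization.Away (h * h')) ((![x, g] : Fin 2 → A) i)) ![1, b])) ∧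
        IsRegularRing (extReesAlgebra (weightedMonomialIdeal
          (fun i => algebraMap A (Localization.Away (h * h')) ((![x, g] : Fin 2 → A) i)) ![1, b])) ∧
        ∀ M : Submonoid (extReesAlgebra (weightedMonomialIdeal
          (fun i => algebraMap A (Localization.Away (h * h')) ((![x, g] : Fin 2 → A) i)) ![1, b])),
          IsRegularRing (Localization M) := by
  haveI : IsNoetherianRing A := Algebra.FiniteType.isNoetherianRing k A
  obtain ⟨h₁, hh₁, H₁⟩ := exists_notMem_forall_isRegularLocalRing k A 𝔭
  obtain ⟨h₂, hh₂, H₂⟩ := exists_open_rsp_pair_along_prime k A 𝔭 hdim x g hxg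
  have hprod : ∀ {𝔮 : Ideal A} [𝔮.IsPrime] {a c : A}, a * c ∉ 𝔮 → a ∉ 𝔮 ∧ c ∉ 𝔮 := fun hac =>
    ⟨fun ha => hac (Ideal.mul_mem_right _ _ ha), fun hc => hac (Ideal.mul_mem_left _ _ hc)⟩
  refine ⟨h₁ * h₂, (‹𝔭.IsPrime›.mul_mem_iff_mem_or_mem.not.mpr (not_or.mpr ⟨hh₁, hh₂⟩)),
    fun 𝔮 _ hh𝔮 => H₁ 𝔮 (hprod hh𝔮).1, fun 𝔮 _ hh𝔮 hx hg => H₂ 𝔮 (hprod hh𝔮).2 hx hg, fun h' => ?_⟩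
  have hreg : ∀ (𝔮 : Ideal A) [𝔮.IsPrime], h₁ * h₂ * h' ∉ 𝔮 → IsRegularLocalRing (Localization.AtPrime 𝔮) :=
    fun 𝔮 _ hh𝔮 => H₁ 𝔮 (hprod (hprod hh𝔮).1).1
  have hli : ∀ (𝔮 : Ideal A) [𝔮.IsPrime], h₁ * h₂ * h' ∉ 𝔮 → x ∈ 𝔮 → g ∈ 𝔮 →
      ∃ h𝔮 : ∀ i, algebraMap A (Localization.AtPrime 𝔮) ((![x, g] : Fin 2 → A) i) ∈ maximalIdeal (Localization.AtPrime 𝔮),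
        LinearIndependent (ResidueField (Localization.AtPrime 𝔮)) fun i =>
          (maximalIdeal (Localization.AtPrime 𝔮)).toCotangent ⟨algebraMap A _ ((![x, g] : Fin 2 → A) i), h𝔮 i⟩ :=
    fun 𝔮 _ hh𝔮 hx hg => (H₂ 𝔮 (hprod (hprod hh𝔮).1).2 hx hg).2.2.2
  haveI hB := isRegularRing_extReesAlgebra_pair_away (h₁ * h₂ * h') x g b hb hreg hli
  exact ⟨isRegularRing_away_of_forall (h₁ * h₂ * h') hreg, finiteType_extReesAlgebra_weightedMonomialIdeal _ _, hB,
    fun M => FRationalResolution.stub_isRegularRing_localization M⟩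

/-! ## rev 2 (res-type-047 ask (a), RULING #10 (V-AQS)): the pair forms with ARBITRARY positive weights `W : Fin 2 → ℕ` (e.g. `(r, q)`) -/

/-- The PAIR form with arbitrary positive weights: the global move `extReesAlgebra (weightedMonomialIdeal (x/1, g/1) W)` over `A_h` is a
regular ring. [cite: Wlodarczyk2022, 2.1.10 and §2.3.9] -/
theorem isRegularRing_extReesAlgebra_pair_away' {A : Type} [CommRing A] [IsNoetherianRing A] (h x g : A) (W : Fin 2 → ℕ)
    (hW : ∀ i, 0 < W i)
    (hreg : ∀ (𝔮 : Ideal A) [𝔮.IsPrime], h ∉ 𝔮 → IsRegularLocalRing (Localization.AtPrime 𝔮))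
    (hli : ∀ (𝔮 : Ideal A) [𝔮.IsPrime], h ∉ 𝔮 → x ∈ 𝔮 → g ∈ 𝔮 →
      ∃ h𝔮 : ∀ i, algebraMap A (Localization.AtPrime 𝔮) ((![x, g] : Fin 2 → A) i) ∈ maximalIdeal (Localization.AtPrime 𝔮),
        LinearIndependent (ResidueField (Localization.AtPrime 𝔮)) fun i =>
          (maximalIdeal (Localization.AtPrime 𝔮)).toCotangent ⟨algebraMap A _ ((![x, g] : Fin 2 → A) i), h𝔮 i⟩) :
    IsRegularRing (extReesAlgebra (weightedMonomialIdeal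
      (fun i => algebraMap A (Localization.Away h) ((![x, g] : Fin 2 → A) i)) W)) :=
  isRegularRing_extReesAlgebra_weightedMonomialIdeal_away h ![x, g] W hW hreg fun 𝔮 _ hh𝔮 hU => hli 𝔮 hh𝔮 (hU 0) (hU 1)

/-- **(G1-reg) with ARBITRARY positive weights** (the (V-AQS) instantiation `W = (r, q)` of res-type-047's in-chart theorem): as
`exists_basicOpen_isRegularRing_globalMove`, for `B = extReesAlgebra (weightedMonomialIdeal (x/1, g/1) W)` over `A_{h h'}`, every `h'`.
[cite: Wlodarczyk2022, 2.1.10 and §2.3.9; Matsumura1987, §30] -/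
theorem exists_basicOpen_isRegularRing_globalMove' (k : Type) [Field k] [PerfectField k] (A : Type) [CommRing A] [Algebra k A]
    [Algebra.FiniteType k A] (𝔭 : Ideal A) [𝔭.IsPrime] [IsRegularLocalRing (Localization.AtPrime 𝔭)]
    (hdim : ringKrullDim (Localization.AtPrime 𝔭) = 2) (x g : A)
    (hxg : (Ideal.span {x, g}).map (algebraMap A (Localization.AtPrime 𝔭)) = maximalIdeal (Localization.AtPrime 𝔭))
    (W : Fin 2 → ℕ) (hW : ∀ i, 0 < W i) :
    ∃ h ∉ 𝔭,
      (∀ (𝔮 : Ideal A) [𝔮.IsPrime], h ∉ 𝔮 → IsRegularLocalRing (Localization.AtPrime 𝔮)) ∧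
      (∀ (𝔮 : Ideal A) [𝔮.IsPrime], h ∉ 𝔮 → x ∈ 𝔮 → g ∈ 𝔮 →
        𝔭 ≤ 𝔮 ∧ IsRegularLocalRing (Localization.AtPrime 𝔮) ∧
        (Ideal.span {x, g}).map (algebraMap A (Localization.AtPrime 𝔮)) = 𝔭.map (algebraMap A (Localization.AtPrime 𝔮)) ∧
        ∃ h𝔮 : ∀ i, algebraMap A (Localization.AtPrime 𝔮) ((![x, g] : Fin 2 → A) i) ∈ maximalIdeal (Localization.AtPrime 𝔮),
          LinearIndependent (ResidueField (Localization.AtPrime 𝔮)) fun i =>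
            (maximalIdeal (Localization.AtPrime 𝔮)).toCotangent ⟨algebraMap A _ ((![x, g] : Fin 2 → A) i), h𝔮 i⟩) ∧
      ∀ h' : A,
        IsRegularRing (Localization.Away (h * h')) ∧
        Algebra.FiniteType (Localization.Away (h * h')) (extReesAlgebra (weightedMonomialIdeal
          (fun i => algebraMap A (Localization.Away (h * h')) ((![x, g] : Fin 2 → A) i)) W)) ∧
        IsRegularRing (extReesAlgebra (weightedMonomialIdeal
          (fun i => algebraMap A (Localization.Away (h * h')) ((![x, g] : Fin 2 → A) i)) W)) ∧
        ∀ M : Submonoid (extReesAlgebra (weightedMonomialIdeal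
          (fun i => algebraMap A (Localization.Away (h * h')) ((![x, g] : Fin 2 → A) i)) W)),
          IsRegularRing (Localization M) := by
  haveI : IsNoetherianRing A := Algebra.FiniteType.isNoetherianRing k A
  obtain ⟨h₁, hh₁, H₁⟩ := exists_notMem_forall_isRegularLocalRing k A 𝔭
  obtain ⟨h₂, hh₂, H₂⟩ := exists_open_rsp_pair_along_prime k A 𝔭 hdim x g hxg
  have hprod : ∀ {𝔮 : Ideal A} [𝔮.IsPrime] {a c : A}, a * c ∉ 𝔮 → a ∉ 𝔮 ∧ c ∉ 𝔮 := fun hac =>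
    ⟨fun ha => hac (Ideal.mul_mem_right _ _ ha), fun hc => hac (Ideal.mul_mem_left _ _ hc)⟩
  refine ⟨h₁ * h₂, (‹𝔭.IsPrime›.mul_mem_iff_mem_or_mem.not.mpr (not_or.mpr ⟨hh₁, hh₂⟩)),
    fun 𝔮 _ hh𝔮 => H₁ 𝔮 (hprod hh𝔮).1, fun 𝔮 _ hh𝔮 hx hg => H₂ 𝔮 (hprod hh𝔮).2 hx hg, fun h' => ?_⟩
  have hreg : ∀ (𝔮 : Ideal A) [𝔮.IsPrime], h₁ * h₂ * h' ∉ 𝔮 → IsRegularLocalRing (Localization.AtPrime 𝔮) :=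
    fun 𝔮 _ hh𝔮 => H₁ 𝔮 (hprod (hprod hh𝔮).1).1
  have hli : ∀ (𝔮 : Ideal A) [𝔮.IsPrime], h₁ * h₂ * h' ∉ 𝔮 → x ∈ 𝔮 → g ∈ 𝔮 →
      ∃ h𝔮 : ∀ i, algebraMap A (Localization.AtPrime 𝔮) ((![x, g] : Fin 2 → A) i) ∈ maximalIdeal (Localization.AtPrime 𝔮),
        LinearIndependent (ResidueField (Localization.AtPrime 𝔮)) fun i =>
          (maximalIdeal (Localization.AtPrime 𝔮)).toCotangent ⟨algebraMap A _ ((![x, g] : Fin 2 → A) i), h𝔮 i⟩ :=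
    fun 𝔮 _ hh𝔮 hx hg => (H₂ 𝔮 (hprod (hprod hh𝔮).1).2 hx hg).2.2.2
  haveI hB := isRegularRing_extReesAlgebra_pair_away' (h₁ * h₂ * h') x g W hW hreg hli
  exact ⟨isRegularRing_away_of_forall (h₁ * h₂ * h') hreg, finiteType_extReesAlgebra_weightedMonomialIdeal _ _, hB,
    fun M => FRationalResolution.stub_isRegularRing_localization M⟩

end ContactCylinder

end Summit.ResolutionOfSingularities.ResolutionOfSingularities.Theorems

end
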